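import Literature.Probability.LatticeModels.RandomCurrentsMixingLattice
import Literature.Probability.LatticeModels.IntersectionPropertyBoxes
import HarnessLib

/-!
# Discharge of `aizenmanDuminilCopin_improvedTreeDiagramBound` (Aizenman–Duminil-Copin 2021, Theorem 1.3)

`theorem aizenmanDuminilCopin_improvedTreeDiagramBound_holds` from
`improvedTreeDiagramBound_of_intersection_and_mixing` (IntersectionClusteringBound.lean) fed with
Lemma 6.2 in finite volume (`intersectionProperty_Hint`, IntersectionPropertyBoxes.lean), and Theorem 6.4 (6.8)/(6.9)
(`Current.mixing_Hmix`, `Current.mixing_Hrel`, RandomCurrentsMixingLattice.lean).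
Separate file because ImprovedTreeDiagramBound.lean is imported by the whole chain (import cycle otherwise).
-/

noncomputable section

namespace Literature.Probability.LatticeModels

/-- **Aizenman–Duminil-Copin 2021, Theorem 1.3 (improved tree diagram bound, d = 4)** — discharged.
[cite: AizenmanDuminilCopinAnnals2021, arXiv:1912.07973 Theorem 1.3 (p. 6); proof §6 + App. A] -/
theorem aizenmanDuminilCopin_improvedTreeDiagramBound_holds : aizenmanDuminilCopin_improvedTreeDiagramBound :=
  improvedTreeDiagramBound_of_intersection_and_mixing intersectionProperty_Hint Current.mixing_Hmix Current.mixing_Hrel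

end Literature.Probability.LatticeModels
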